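import Mathlib

/-!
# X193 kernel line, file F2: the abstract service structure (layer A1, data and axioms)

Solo seat `solo-Schanuel-informed`, X193 kernel programme (design note
`work/s213/X193-KERNEL-DESIGN.md`; pen proof `work/s194/X193-pen.md`; file F1 =
`SoloInformedX193Inequalities`).

The cross-level count behind THEOREM X193 never looks at a polynomial: it only uses, for
the irreducible factors `P` ("pieces") of the enemy polynomials `R_n`, their degrees `g_P`,
log-heights `L_P`, multiplicities `m_P(n)`, the "banks" `d_P^k = -log |P(kξ)|` at the columns
`k`, a near-root relation, and the twisting operation `P(T) ↦ prim (j^g P(kT/j))`, subject to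
a short list of inequalities: the budgets (Bud), the service identity (Srv), the resultant
inequality for pairs (PAIR) and for a piece against a level where it is not a factor (L1),
the twist laws (TW) and two finiteness facts (FIN).  This file records that data as a
structure `SoloServiceData` and each axiom family as a `Set`-valued definition (membership
= the axiom holds), together with the derived notions used by the count: cost
`C_P(n) = g_P n^β + L_P n`, cap, entry level of the current life, primordial pieces.
Layer B of the programme instantiates the structure from a sequence
`R_n ∈ RoyAdditiveSmall ξ β σ 0 ν n` and proves the axioms (PAIR and L1 from
`Literature.NumberTheory.Transcendental.Roy2010.prop_3_1` with `t = 1`).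
Only definitions and their immediate API are in this file; no sorries.
-/

namespace Summit.Schanuel.Schanuel.Theorems

open Finset

/-- Abstract service data (DESIGN §1, layer A1): pieces `ι` with degree, log-height, the
finite set of pieces alive at each level with multiplicities, banks at the columns, a
near-root relation and a twisting operation `twist P k j` ("carry column `k` of `P` to
column `j`").  No axioms are built in; they are the `Set`-valued definitions below. -/
structure SoloServiceData (ι : Type*) where
  /-- degree `g_P` of a piece -/
  deg : ι → ℕ
  /-- logarithmic height `L_P = log ‖P‖` of a piece -/
  logHt : ι → ℝ
  /-- the pieces alive at level `n` (the irreducible factors of `R_n`) -/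
  alive : ℕ → Finset ι
  /-- multiplicity of `P` at level `n` (`0` when `P` is not alive) -/
  mult : ι → ℕ → ℕ
  /-- bank of `P` at column `k`, i.e. `-log |P(kξ)|` -/
  bank : ι → ℕ → ℝ
  /-- near-root relation: `P` has a root within `|ξ|/2` of `kξ` -/
  nearRoot : ι → ℕ → Bool
  /-- `twist P k j`: the primitive dilate of `P` carrying column `k` to column `j` -/
  twist : ι → ℕ → ℕ → ι

namespace SoloServiceData

variable {ι : Type*} (D : SoloServiceData ι)

/-- Cost of `P` at level `n`: `C_P(n) = g_P n^β + L_P n` (the main term of (L1)). -/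
noncomputable def cost (β : ℝ) (P : ι) (n : ℕ) : ℝ :=
  (D.deg P : ℝ) * (n : ℝ) ^ β + D.logHt P * n

/-- Cap of `P` at level `n`: `2 g_P L_P + B g_P² log (n + 2)`; a near-root column with bank
above the cap is "deep" (at most one per piece, by (PAIR) against the twists). -/
noncomputable def cap (B : ℝ) (P : ι) (n : ℕ) : ℝ :=
  2 * (D.deg P : ℝ) * D.logHt P + B * (D.deg P : ℝ) ^ 2 * Real.log ((n : ℝ) + 2)

/-- There is a level `e` (for instance `n + 1`) from which `P` is alive up to `n`;
the least such `e` is the entry level. -/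
theorem exists_alive_between (P : ι) (n : ℕ) :
    ∃ e : ℕ, ∀ ℓ : ℕ, e ≤ ℓ → ℓ ≤ n → P ∈ D.alive ℓ :=
  ⟨n + 1, fun ℓ h1 h2 => absurd (h1.trans h2) (by omega)⟩

open scoped Classical in
/-- Entry level of the current life of `P` at level `n`: the least `e` such that `P` is
alive at every level of `[e, n]` (equal to `n + 1` when `P` is not alive at `n`). -/
noncomputable def entry (P : ι) (n : ℕ) : ℕ := Nat.find (D.exists_alive_between P n)

open scoped Classical in
/-- `P` is alive on the whole interval `[entry P n, n]`. -/
theorem alive_of_entry_le (P : ι) (n ℓ : ℕ) (h1 : D.entry P n ≤ ℓ) (h2 : ℓ ≤ n) :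
    P ∈ D.alive ℓ :=
  (Nat.find_spec (D.exists_alive_between P n)) ℓ h1 h2

open scoped Classical in
/-- Minimality of the entry level: any `e` from which `P` stays alive up to `n` is at
least `entry P n`. -/
theorem entry_le_of_alive (P : ι) (n e : ℕ)
    (h : ∀ ℓ : ℕ, e ≤ ℓ → ℓ ≤ n → P ∈ D.alive ℓ) : D.entry P n ≤ e :=
  Nat.find_min' (D.exists_alive_between P n) h

/-- The entry level never exceeds `n + 1`. -/
theorem entry_le_succ (P : ι) (n : ℕ) : D.entry P n ≤ n + 1 :=
  D.entry_le_of_alive P n (n + 1) fun ℓ h1 h2 => absurd (h1.trans h2) (by omega)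

/-- `entry P n ≤ n` exactly when `P` is alive at level `n`. -/
theorem entry_le_iff_alive (P : ι) (n : ℕ) : D.entry P n ≤ n ↔ P ∈ D.alive n := by
  constructor
  · intro h
    exact D.alive_of_entry_le P n n h le_rfl
  · intro h
    refine D.entry_le_of_alive P n n fun ℓ h1 h2 => ?_
    have : ℓ = n := le_antisymm h2 h1
    rw [this]; exact h

/-- If the entry level `e = entry P n` is positive, then `P` is NOT alive at `e - 1`
(the life really starts at `e`; when `P` is not alive at `n` this says so, `e = n + 1`). -/
theorem not_alive_pred_entry (P : ι) (n : ℕ) (hpos : 0 < D.entry P n) :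
    P ∉ D.alive (D.entry P n - 1) := by
  intro hmem
  have h : ∀ ℓ : ℕ, D.entry P n - 1 ≤ ℓ → ℓ ≤ n → P ∈ D.alive ℓ := by
    intro ℓ h1 h2
    rcases Nat.lt_or_ge ℓ (D.entry P n) with hlt | hge
    · have : ℓ = D.entry P n - 1 := by omega
      rw [this]; exact hmem
    · exact D.alive_of_entry_le P n ℓ hge h2
  have := D.entry_le_of_alive P n _ h
  omega

/-- Monotonicity of lives: for `ℓ ∈ [entry P n, n]` the life of `P` at `ℓ` has the same
entry level. -/
theorem entry_eq_of_mem_life (P : ι) (n ℓ : ℕ) (h1 : D.entry P n ≤ ℓ) (h2 : ℓ ≤ n) :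
    D.entry P ℓ = D.entry P n := by
  apply le_antisymm
  · exact D.entry_le_of_alive P ℓ _ fun ℓ' h1' h2' =>
      D.alive_of_entry_le P n ℓ' h1' (h2'.trans h2)
  · refine D.entry_le_of_alive P n _ fun ℓ' h1' h2' => ?_
    rcases le_total ℓ' ℓ with hle | hge
    · exact D.alive_of_entry_le P ℓ ℓ' h1' hle
    · exact D.alive_of_entry_le P n ℓ' (h1.trans hge) h2'

/-- Primordial pieces at level `n` (with respect to the first level `n₀` of the enemy):
those whose current life started at or before `n₀`. -/
def primordial (n₀ n : ℕ) : Set ι := {P | D.entry P n ≤ n₀}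

/-- Deep columns of `P` at level `n`: active (`1 ≤ k ≤ n^σ`) near-root columns whose bank
exceeds the cap. -/
def deepCols (σ B : ℝ) (P : ι) (n : ℕ) : Set ℕ :=
  {k | 1 ≤ k ∧ (k : ℝ) ≤ (n : ℝ) ^ σ ∧ D.nearRoot P k = true ∧ D.cap B P n < D.bank P k}

/-! ### The axiom families (membership = the axiom holds) -/

/-- (WF) well-formedness: degrees `≥ 1`, log-heights `≥ 0`, multiplicity positive exactly
on the alive pieces; non-near-root banks are small, `d_P^k ≤ c₀ g_P` (NRb); a piece is
near-root at no more than `g_P` columns (NRc). -/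
def wellFormed (c₀ : ℝ) : Set (SoloServiceData ι) :=
  {D | (∀ P, 1 ≤ D.deg P) ∧ (∀ P, 0 ≤ D.logHt P) ∧
    (∀ P n, P ∈ D.alive n ↔ 1 ≤ D.mult P n) ∧
    (∀ P k, D.nearRoot P k = false → D.bank P k ≤ c₀ * D.deg P) ∧
    (∀ P (S : Finset ℕ), (∀ k ∈ S, D.nearRoot P k = true) → S.card ≤ D.deg P)}

/-- (Bud) at every level `n ≥ n₀`: `Σ m_P g_P ≤ n` and `Σ m_P L_P ≤ n^β + b₁ n`
(degree of `R_n`; Mahler's inequality for the factors of `R_n`). -/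
def budgetLaw (β b₁ : ℝ) (n₀ : ℕ) : Set (SoloServiceData ι) :=
  {D | ∀ n, n₀ ≤ n →
    (∑ P ∈ D.alive n, (D.mult P n : ℝ) * D.deg P) ≤ n ∧
    (∑ P ∈ D.alive n, (D.mult P n : ℝ) * D.logHt P) ≤ (n : ℝ) ^ β + b₁ * n}

/-- (Srv) at every level `n ≥ n₀` and active column `1 ≤ k ≤ n^σ`:
`Σ m_P d_P^k ≥ n^ν - c₀ n` (evaluate the factorisation of `R_n` at `kξ`). -/
def serviceLaw (σ ν c₀ : ℝ) (n₀ : ℕ) : Set (SoloServiceData ι) :=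
  {D | ∀ n, n₀ ≤ n → ∀ k : ℕ, 1 ≤ k → (k : ℝ) ≤ (n : ℝ) ^ σ →
    (n : ℝ) ^ ν - c₀ * n ≤ ∑ P ∈ D.alive n, (D.mult P n : ℝ) * D.bank P k}

/-- (PAIR) for distinct pieces `P ≠ Q` and columns `S ⊆ [1, K]`:
`Σ_{k∈S} min (d_P^k, d_Q^k) ≤ g_Q L_P + g_P L_Q + A₁ (g_P + g_Q + |S|)² log (K + 2)`
(Roy 2010, Prop. 3.1 with `t = 1`). -/
def pairLaw (A₁ : ℝ) : Set (SoloServiceData ι) :=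
  {D | ∀ P Q, P ≠ Q → ∀ (K : ℕ) (S : Finset ℕ), (∀ k ∈ S, 1 ≤ k ∧ k ≤ K) →
    (∑ k ∈ S, min (D.bank P k) (D.bank Q k)) ≤
      D.deg Q * D.logHt P + D.deg P * D.logHt Q +
        A₁ * ((D.deg P : ℝ) + D.deg Q + S.card) ^ 2 * Real.log ((K : ℝ) + 2)}

/-- (L1) for a piece `P` NOT alive at a level `ℓ ≥ n₀` and active columns `S` of `ℓ`:
`Σ_{k∈S} min (d_P^k, ℓ^ν) ≤ C_P(ℓ) + A₂ (ℓ + g_P + |S|)² log (ℓ + 2)`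
(Prop. 3.1 for the coprime pair `(P, R_ℓ)`, using `|R_ℓ(kξ)| ≤ exp (-ℓ^ν)`). -/
def entryLaw (β σ ν A₂ : ℝ) (n₀ : ℕ) : Set (SoloServiceData ι) :=
  {D | ∀ P (ℓ : ℕ), n₀ ≤ ℓ → P ∉ D.alive ℓ → ∀ S : Finset ℕ,
    (∀ k ∈ S, 1 ≤ k ∧ (k : ℝ) ≤ (ℓ : ℝ) ^ σ) →
    (∑ k ∈ S, min (D.bank P k) ((ℓ : ℝ) ^ ν)) ≤
      D.cost β P ℓ + A₂ * ((ℓ : ℝ) + D.deg P + S.card) ^ 2 * Real.log ((ℓ : ℝ) + 2)}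

/-- (TW) twist laws for columns `k, j, j' ≥ 1`: identity, composition, injectivity in the
target column, degree preserved, height and bank transported up to `g_P log (max k j)`. -/
def twistLaw : Set (SoloServiceData ι) :=
  {D | ∀ P (k j j' : ℕ), 1 ≤ k → 1 ≤ j → 1 ≤ j' →
    D.twist P k k = P ∧ D.twist (D.twist P k j) j j' = D.twist P k j' ∧
    (j ≠ j' → D.twist P k j ≠ D.twist P k j') ∧ D.deg (D.twist P k j) = D.deg P ∧
    D.logHt (D.twist P k j) ≤ D.logHt P + D.deg P * Real.log (max k j : ℕ) ∧
    D.bank P k - D.deg P * Real.log (max k j : ℕ) ≤ D.bank (D.twist P k j) j}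

/-- (FIN) the pieces alive at any fixed level have uniformly bounded banks
(finitely many pieces, `|P(kξ)| → ∞`). -/
def finiteLaw : Set (SoloServiceData ι) :=
  {D | ∀ m₀ : ℕ, ∃ Dm : ℝ, ∀ P ∈ D.alive m₀, ∀ k : ℕ, 1 ≤ k → D.bank P k ≤ Dm}

/-! ### Immediate consequences used throughout -/

/-- Under (WF) an alive piece has multiplicity `≥ 1` (as a real number). -/
theorem one_le_mult_of_alive {c₀ : ℝ} (hW : D ∈ wellFormed c₀) {P : ι} {n : ℕ}
    (h : P ∈ D.alive n) : (1 : ℝ) ≤ D.mult P n := by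
  have := (hW.2.2.1 P n).mp h
  exact_mod_cast this

/-- Under (WF) and (Bud), an alive piece has degree at most the level. -/
theorem deg_le_level {c₀ β b₁ : ℝ} {n₀ : ℕ} (hW : D ∈ wellFormed c₀)
    (hB : D ∈ budgetLaw β b₁ n₀) {P : ι} {n : ℕ} (hn : n₀ ≤ n) (h : P ∈ D.alive n) :
    (D.deg P : ℝ) ≤ n := by
  have h1 := (hB n hn).1
  have hsingle : (D.mult P n : ℝ) * D.deg P ≤
      ∑ Q ∈ D.alive n, (D.mult Q n : ℝ) * D.deg Q := by
    apply Finset.single_le_sum (f := fun Q => (D.mult Q n : ℝ) * D.deg Q) _ h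
    intro Q _
    positivity
  have hm : (1 : ℝ) ≤ D.mult P n := D.one_le_mult_of_alive hW h
  have hg : (0 : ℝ) ≤ D.deg P := by positivity
  nlinarith

/-- The cost is at least `n ^ β` for an honest piece (`g_P ≥ 1`, `L_P ≥ 0`). -/
theorem rpow_le_cost {c₀ : ℝ} (hW : D ∈ wellFormed c₀) (β : ℝ) (P : ι) (n : ℕ) :
    (n : ℝ) ^ β ≤ D.cost β P n := by
  unfold cost
  have hg : (1 : ℝ) ≤ D.deg P := by exact_mod_cast hW.1 P
  have hL : 0 ≤ D.logHt P := hW.2.1 P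
  have hnb : 0 ≤ (n : ℝ) ^ β := by positivity
  have hn : (0 : ℝ) ≤ n := by positivity
  nlinarith [mul_nonneg hL hn]

/-- Cost is monotone in the level (for `β ≥ 0`). -/
theorem cost_mono {c₀ : ℝ} (hW : D ∈ wellFormed c₀) {β : ℝ} (hβ : 0 ≤ β) (P : ι)
    {m n : ℕ} (h : m ≤ n) : D.cost β P m ≤ D.cost β P n := by
  unfold cost
  have hg : (0 : ℝ) ≤ D.deg P := by positivity
  have hL : 0 ≤ D.logHt P := hW.2.1 P
  have hmn : (m : ℝ) ≤ n := by exact_mod_cast h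
  have hpow : (m : ℝ) ^ β ≤ (n : ℝ) ^ β :=
    Real.rpow_le_rpow (by positivity) hmn hβ
  nlinarith [mul_le_mul_of_nonneg_left hpow hg, mul_le_mul_of_nonneg_left hmn hL]

end SoloServiceData

end Summit.Schanuel.Schanuel.Theorems
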